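import Summits.QuantumAdvantage.QuantumAdvantage.Theorems.CompositeFrameBound.Negative.LoadBearing
import Summits.QuantumAdvantage.QuantumAdvantage.Theorems.SymplecticPuritySymplecticPurityBoundKernel
import Summits.QuantumAdvantage.QuantumAdvantage.Theorems.SymplecticPuritySymplecticPurityBoundPauli

/-!
# `CompositeFrameBound` (stmt-QuantumAdvantage-10730), line `Sketch` — stub `stub_reduction`

This file is the stub `stub_reduction` of line `Sketch` of the crux
`SymplecticPurity.CompositeFrameBound` (stmt-QuantumAdvantage-10730), adapted from
`Cruxes/CompositeFrameBound/Disproof.lean` §3–§5 of refuter-cdisprove-stmt-QuantumAdvantage-10730-g2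
(the refuter's PROVED `U₂`-free reduction), in FAMILY form.

For a unit vector `χ`, a semantic-Clifford unitary `V` (label map `f`, `V σ_S V† = c(S) σ_{f S}`)
and a cut `k ≤ N`:

* the purity of the cut `{wires < k}` of `V χ` is the spectral mass
  `2^{-k} Σ_{Q ∈ 𝒫^{<k} ⊗ I} |⟨Vχ|Q|Vχ⟩|²` (`cutPurity` unfolds to the 4-fold agreement sum of
  `fourFold_eq_spectralMass`, Kempe–Regev–Unger–de Wolf Observation 3 + Parseval);
* the Clifford `V` relabels the strings bijectively, fixing the identity string
  (`sum_stringsOn_norm_exp_sq_clifford`, `clifford_injective`, `clifford_map_I`), so that mass is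
  `Σ_{T : f T ∈ 𝒫^{<k} ⊗ I} |⟨χ|T|χ⟩|²`, a sum over `4^k` strings containing `I`;
* the identity term is `|⟨χ|χ⟩|² = 1`, and the remaining `≤ 4^k` non-identity strings form the
  family `𝒯` with `‖cutPurity (Vχ) k‖ = 2^{-k} (1 + Σ_{S ∈ 𝒯} |⟨χ|S|χ⟩|²)`
  (`cfb_norm_cutPurity_mulVec_eq_family`).

Hence a bound `2^{-k}(1 + Σ_{S ∈ 𝒯} |⟨χ|S|χ⟩|²) ≤ 2^{-cn}` valid for EVERY family `𝒯` of at most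
`4^k` non-identity strings, at `χ = U U₁ ĝ`, gives the crux in its schema form
`FrameBound Clifford Clifford Gaussian` (`stub_reduction`).
-/

set_option linter.dupNamespace false -- D-0017: single-problem summit ⇒ `QuantumAdvantage.QuantumAdvantage` by design

noncomputable section

namespace Summit.QuantumAdvantage.QuantumAdvantage.Theorems.SymplecticPurity.CompositeFrameBound

open Literature.Computability.Cryptography Literature.Computability.QuantumComplexity Matrix Finset
open Summit.QuantumAdvantage.QuantumAdvantage.Theorems.CompositeFrameBound.Negative
open Summit.QuantumAdvantage.QuantumAdvantage.Theorems.SymplecticPurity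

-- adapted from Summits/QuantumAdvantage/QuantumAdvantage/Cruxes/CompositeFrameBound/Disproof.lean §3–§5

/-! ## Counting strings; splitting off the identity after a Clifford relabelling -/

section Generic

variable {ι : Type*} [Fintype ι] [DecidableEq ι]

/-- `|𝒫^W ⊗ I| = 4^{|W|}`: the strings supported in `W` number `4^{|W|}`. -/
theorem cfb_card_stringsOn (W : Finset ι) : (stringsOn W).card = 4 ^ W.card := by
  rw [stringsOn, Fintype.card_piFinset]
  have : ∀ i : ι, (if i ∈ W then (Finset.univ : Finset Pauli) else {Pauli.I}).card =
      if i ∈ W then 4 else 1 := by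
    intro i
    split_ifs
    · rw [Finset.card_univ, Pauli.card_univ]
    · rfl
  simp only [this, Finset.prod_ite, Finset.prod_const, one_pow, mul_one, Finset.filter_univ_mem]

/-- The preimage of `𝒫^A ⊗ I` under the (injective) label map of a Clifford unitary, with the
identity string removed, has at most `4^{|A|}` elements. -/
theorem cfb_card_filter_erase_le {U : Matrix (ι → Bool) (ι → Bool) ℂ} (hU : Uᴴ * U = 1)
    {f : (ι → Pauli) → (ι → Pauli)} {c : (ι → Pauli) → ℂ}
    (hf : ∀ S, ‖c S‖ = 1 ∧ U * pauliString S * Uᴴ = c S • pauliString (f S)) (A : Finset ι) :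
    ((Finset.univ.filter fun T => f T ∈ stringsOn A).erase (fun _ => Pauli.I)).card ≤
      4 ^ A.card :=
  calc ((Finset.univ.filter fun T => f T ∈ stringsOn A).erase (fun _ => Pauli.I)).card
      ≤ (Finset.univ.filter fun T => f T ∈ stringsOn A).card := Finset.card_erase_le
    _ ≤ (stringsOn A).card := Finset.card_le_card_of_injOn f
        (fun _ hT => (Finset.mem_filter.1 (Finset.mem_coe.1 hT)).2)
        (clifford_injective hU hf).injOn
    _ = 4 ^ A.card := cfb_card_stringsOn A

/-- **Splitting off the identity string after the Clifford relabelling.** For a unit vector `χ`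
and a Clifford unitary `U` with label map `f`, the spectral mass of `Uχ` on `𝒫^A ⊗ I` is
`1 +` the mass of `χ` on the non-identity strings `T` with `f T ∈ 𝒫^A ⊗ I`. -/
theorem cfb_sum_stringsOn_clifford_split (χ : (ι → Bool) → ℂ) (hχ : star χ ⬝ᵥ χ = 1)
    {U : Matrix (ι → Bool) (ι → Bool) ℂ} (hU : Uᴴ * U = 1) (hU' : U * Uᴴ = 1)
    {f : (ι → Pauli) → (ι → Pauli)} {c : (ι → Pauli) → ℂ}
    (hf : ∀ S, ‖c S‖ = 1 ∧ U * pauliString S * Uᴴ = c S • pauliString (f S)) (A : Finset ι) :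
    ∑ Q ∈ stringsOn A, ‖star (U *ᵥ χ) ⬝ᵥ (pauliString Q *ᵥ (U *ᵥ χ))‖ ^ 2 =
      1 + ∑ T ∈ (Finset.univ.filter fun T => f T ∈ stringsOn A).erase (fun _ => Pauli.I),
        ‖star χ ⬝ᵥ (pauliString T *ᵥ χ)‖ ^ 2 := by
  have hI : (fun _ => Pauli.I) ∈ (Finset.univ.filter fun T => f T ∈ stringsOn A) := by
    rw [Finset.mem_filter, clifford_map_I hU' hf]
    exact ⟨Finset.mem_univ _, mem_stringsOn.2 fun _ _ => rfl⟩
  rw [sum_stringsOn_norm_exp_sq_clifford hU hf χ A,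
    ← Finset.add_sum_erase _ (fun T => ‖star χ ⬝ᵥ (pauliString T *ᵥ χ)‖ ^ 2) hI,
    pauliString_const_I, Matrix.one_mulVec, hχ, norm_one, one_pow]

end Generic

/-! ## Purity of the cut `{wires < k}` of a qubit register as spectral mass -/

/-- The low wire set `{i : i < k}` has `k` elements when `k ≤ N`. -/
theorem cfb_card_filter_lt {N k : ℕ} (hk : k ≤ N) :
    (Finset.univ.filter fun i : Fin N => i.val < k).card = k := by
  have : (Finset.univ.filter fun i : Fin N => i.val < k) = Finset.univ.map (Fin.castLEEmb hk) := by
    ext i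
    simp only [Finset.mem_filter, Finset.mem_univ, true_and, Finset.mem_map]
    constructor
    · intro hi
      exact ⟨⟨i, hi⟩, Fin.ext rfl⟩
    · rintro ⟨j, rfl⟩
      exact j.2
  rw [this, Finset.card_map, Finset.card_univ, Fintype.card_fin]

/-- `cutPurity` IS the 4-fold agreement sum of `fourFold_eq_spectralMass` across the cut
`W = {i : i < k}` (the conditions `k ≤ i` / `i < k` are `i ∉ W` / `i ∈ W`). -/
theorem cfb_cutPurity_eq_fourFold {N : ℕ} (ψ : QReg N → ℂ) (k : ℕ) :
    cutPurity ψ k = ∑ x₁ : QReg N, ∑ x₂ : QReg N, ∑ x₃ : QReg N, ∑ x₄ : QReg N,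
      (if (∀ i ∉ (Finset.univ.filter fun i : Fin N => i.val < k), x₁ i = x₂ i) ∧
          (∀ i ∈ (Finset.univ.filter fun i : Fin N => i.val < k), x₂ i = x₃ i) ∧
          (∀ i ∉ (Finset.univ.filter fun i : Fin N => i.val < k), x₃ i = x₄ i) ∧
          (∀ i ∈ (Finset.univ.filter fun i : Fin N => i.val < k), x₄ i = x₁ i)
        then ψ x₁ * star (ψ x₂) * ψ x₃ * star (ψ x₄) else 0) := by
  unfold cutPurity
  refine Finset.sum_congr rfl fun x₁ _ => Finset.sum_congr rfl fun x₂ _ =>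
    Finset.sum_congr rfl fun x₃ _ => Finset.sum_congr rfl fun x₄ _ => if_congr ?_ rfl rfl
  simp only [Finset.mem_filter, Finset.mem_univ, true_and, not_lt]

/-- **Purity = spectral mass on the cut**:
`‖cutPurity ψ k‖ = 2^{-k} Σ_{S ∈ 𝒫^{<k} ⊗ I} |⟨ψ|S|ψ⟩|²` for `k ≤ N`. -/
theorem cfb_norm_cutPurity_eq {N : ℕ} (ψ : QReg N → ℂ) {k : ℕ} (hk : k ≤ N) :
    ‖cutPurity ψ k‖ = ((2 : ℝ) ^ k)⁻¹ *
      ∑ S ∈ stringsOn (Finset.univ.filter fun i : Fin N => i.val < k),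
        ‖star ψ ⬝ᵥ (pauliString S *ᵥ ψ)‖ ^ 2 := by
  have hnn : 0 ≤ ((2 : ℝ) ^ k)⁻¹ *
      ∑ S ∈ stringsOn (Finset.univ.filter fun i : Fin N => i.val < k),
        ‖star ψ ⬝ᵥ (pauliString S *ᵥ ψ)‖ ^ 2 :=
    mul_nonneg (inv_nonneg.2 (pow_nonneg zero_le_two k)) (Finset.sum_nonneg fun _ _ => sq_nonneg _)
  rw [cfb_cutPurity_eq_fourFold,
    fourFold_eq_spectralMass ψ (Finset.univ.filter fun i : Fin N => i.val < k),
    Complex.norm_real, Real.norm_eq_abs, cfb_card_filter_lt hk, abs_of_nonneg hnn]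

/-! ## The one-frame reduction -/

/-- Unitary-group membership in `ᴴ` form: `Uᴴ U = 1`. -/
theorem cfb_conjTranspose_mul_self {N : ℕ} {U : Matrix (QReg N) (QReg N) ℂ}
    (hu : U ∈ Matrix.unitaryGroup (QReg N) ℂ) : Uᴴ * U = 1 := by
  rw [← Matrix.star_eq_conjTranspose]
  exact Matrix.mem_unitaryGroup_iff'.1 hu

/-- Unitary-group membership in `ᴴ` form: `U Uᴴ = 1`. -/
theorem cfb_mul_conjTranspose_self {N : ℕ} {U : Matrix (QReg N) (QReg N) ℂ}
    (hu : U ∈ Matrix.unitaryGroup (QReg N) ℂ) : U * Uᴴ = 1 := by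
  rw [← Matrix.star_eq_conjTranspose]
  exact Matrix.mem_unitaryGroup_iff.1 hu

/-- The label map and phases of a semantic Clifford unitary, in the `ᴴ` form of the toolkit of
`SymplecticPuritySymplecticPurityBoundPauli`. -/
theorem cfb_exists_labelMap {N : ℕ} {V : Matrix (QReg N) (QReg N) ℂ} (hV : IsCliffordU V) :
    ∃ f : (Fin N → Pauli) → (Fin N → Pauli), ∃ c : (Fin N → Pauli) → ℂ,
      ∀ S, ‖c S‖ = 1 ∧ V * pauliString S * Vᴴ = c S • pauliString (f S) := by
  choose f c hc using hV
  exact ⟨f, c, fun S => by rw [← Matrix.star_eq_conjTranspose]; exact hc S⟩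

/-- **The `U₂`-free reduction, family form (one frame).** For a unit vector `χ`, a
semantic-Clifford unitary `V` and a cut `k ≤ N`, there is a family `𝒯` of at most `4^k`
NON-IDENTITY Pauli strings with `‖cutPurity (Vχ) k‖ = 2^{-k} (1 + Σ_{S ∈ 𝒯} |⟨χ|S|χ⟩|²)`
(namely the preimage of `𝒫^{<k} ⊗ I` under the label map of `V`, minus the identity). -/
theorem cfb_norm_cutPurity_mulVec_eq_family {N : ℕ} (χ : QReg N → ℂ) (hχ : star χ ⬝ᵥ χ = 1)
    {V : Matrix (QReg N) (QReg N) ℂ} (hV : IsCliffordU V)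
    (hv : V ∈ Matrix.unitaryGroup (QReg N) ℂ) {k : ℕ} (hk : k ≤ N) :
    ∃ 𝒯 : Finset (Fin N → Pauli), (fun _ => Pauli.I) ∉ 𝒯 ∧ 𝒯.card ≤ 4 ^ k ∧
      ‖cutPurity (V *ᵥ χ) k‖ =
        ((2 : ℝ) ^ k)⁻¹ * (1 + ∑ S ∈ 𝒯, ‖star χ ⬝ᵥ (pauliString S *ᵥ χ)‖ ^ 2) := by
  obtain ⟨f, c, hf⟩ := cfb_exists_labelMap hV
  have hU : Vᴴ * V = 1 := cfb_conjTranspose_mul_self hv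
  have hU' : V * Vᴴ = 1 := cfb_mul_conjTranspose_self hv
  refine ⟨(Finset.univ.filter fun T => f T ∈
      stringsOn (Finset.univ.filter fun i : Fin N => i.val < k)).erase (fun _ => Pauli.I),
    Finset.notMem_erase _ _, ?_, ?_⟩
  · have h := cfb_card_filter_erase_le hU hf (Finset.univ.filter fun i : Fin N => i.val < k)
    rwa [cfb_card_filter_lt hk] at h
  · rw [cfb_norm_cutPurity_eq _ hk, cfb_sum_stringsOn_clifford_split χ hχ hU hU' hf]

/-! ## The stub -/

/-- **stub_reduction** (line `Sketch` of crux stmt-QuantumAdvantage-10730; known proof: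
`Disproof.lean` §3–§5 in family form).  If for all large `n`, every field/identification and every
Clifford `U₁` / Gaussian `U` there is a cut `k ≤ 2n` such that every family `𝒯` of at most `4^k`
non-identity Pauli strings carries squared expectation mass `M` on `χ = U U₁ ĝ` with
`2^{-k}(1 + M) ≤ 2^{-cn}`, then the crux holds — written as the schema
`FrameBound Clifford Clifford Gaussian` of `LoadBearing` (`crux_iff : CompositeFrameBound ↔ …` is
`Iff.rfl`): purity = spectral mass on the cut, and a Clifford `U₂` only relabels the `4^k` strings
injectively, fixing `I` (`cfb_norm_cutPurity_mulVec_eq_family`). -/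
theorem stub_reduction :
    (∃ c : ℝ, 0 < c ∧ ∃ n₀ : ℕ, ∀ n ≥ n₀, ∀ (K : Type) [Field K] [Fintype K],
      Fintype.card K = 2 ^ n → ∀ e : K ≃+ (Fin n → ZMod 2),
      ∀ U₁ U : Matrix (QReg (n + n)) (QReg (n + n)) ℂ,
      U₁ ∈ Matrix.unitaryGroup (QReg (n + n)) ℂ → IsCliffordU U₁ →
      U ∈ Matrix.unitaryGroup (QReg (n + n)) ℂ → IsGaussianU U →
      ∃ k ≤ n + n, ∀ 𝒯 : Finset (Fin (n + n) → Pauli), (fun _ => Pauli.I) ∉ 𝒯 → 𝒯.card ≤ 4 ^ k →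
        ((2 : ℝ) ^ k)⁻¹ * (1 + ∑ S ∈ 𝒯, ‖star (U *ᵥ (U₁ *ᵥ ghat n K e)) ⬝ᵥ
            (pauliString S *ᵥ (U *ᵥ (U₁ *ᵥ ghat n K e)))‖ ^ 2) ≤ (2 : ℝ) ^ (-(c * (n : ℝ)))) →
    FrameBound (fun _ => IsCliffordU) (fun _ => IsCliffordU) (fun _ => IsGaussianU) := by
  rintro ⟨c, hc, n₀, H⟩
  refine ⟨c, hc, n₀, fun n hn K _ _ hK e U₁ U₂ U hu1 hc1 hu2 hc2 hu hg => ?_⟩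
  obtain ⟨k, hk, hfam⟩ := H n hn K hK e U₁ U hu1 hc1 hu hg
  refine ⟨k, hk, ?_⟩
  have hχ : star (U *ᵥ (U₁ *ᵥ ghat n K e)) ⬝ᵥ (U *ᵥ (U₁ *ᵥ ghat n K e)) = 1 := by
    rw [star_mulVec_dotProduct_mulVec (cfb_conjTranspose_mul_self hu),
      star_mulVec_dotProduct_mulVec (cfb_conjTranspose_mul_self hu1), star_ghat_dotProduct_ghat]
  obtain ⟨𝒯, hI, hcard, hEq⟩ := cfb_norm_cutPurity_mulVec_eq_family _ hχ hc2 hu2 hk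
  rw [hEq]
  exact hfam 𝒯 hI hcard

end Summit.QuantumAdvantage.QuantumAdvantage.Theorems.SymplecticPurity.CompositeFrameBound

end
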